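import Summits.QuantumFields.YangMills.Theorems.BalabanUVNodesN12AtRecord13TermPinnedLambda
import Literature.MathematicalPhysics.QuantumFieldTheory.Balaban1983to89.Node00.Record13NumericsOfThm1CC1

/-!
# BalabanUVNodes ∕ N12 — N12's ROWS AT THE WITNESS OF THE C¹ ROUTE `θ₁₅ᶜᶜ¹ = theta13OfThm1CC1 F N ε₀ ε₂₉ B₃ B₃' a₀ a₁` (node00-def-K0a FILE 13a `Node00/Record13NumericsOfThm1CC1`,
# p505383): the [IV] leaf from the per-run displays, the whole-tower form, the `Λ`-pinned most-pinned row, its non-vacuity certificate, and the three term-constant signs — ALL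
# EDITION-FREE (no proviso row, no record predicate: they serve the ‴, ⁗ and ⁵ records alike) (Track A, DAG node N12 = [B15, Balaban1989LargeFieldI] CMP **122** (1989) 175–202;
# cluster K1 (K1⁗ `StabilityBAtRecordR13Sep` = stmt-QuantumFields-20290 → K1⁵ at rev 20); seat `pub-ymgap-dag-n12-d` g9 (R134 s2 «knit at the record»), 2026-08-27; count-neutral,
# NOT a discharge)

HONEST FRAMING.  Count-neutral kernel INSTANTIATION BY NAME of this seat's generic-`Θ` rows (12E `…N12AtRecord13OfResiduals` §1, 14C `…N12AtRecord13TermPinned` §1, 12I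
`…N12AtRecord13TermPinnedLambda` §1 — every row a theorem of K0b's `HasResidualsOfRecord` at a live re-pin) AT node00-def-K0a's C¹-route witness `θ₁₅ᶜᶜ¹` (FILE 13a:
`theta13OfThm1CC1 F N ε₀ ε₂₉ B₃ B₃' a₀ a₁ := theta13LiveOfNumerics F N (stage12NumericsOfThm1CC1 F.L ε₀ B₃ B₃' a₀ a₁) ε₂₉ …`, i.e. `(theta13OfNumerics …).liveRepin₁₃` by `rfl`; K0b's
residuals of record by K0a's `hasResidualsOfRecord_theta13OfNumerics`, admissibility by `admissible_theta13OfThm1CC1` under the SIX witness signs `0 < ε₀`, `0 < ε₂₉`, `0 ≤ B₃`, `0 ≤ B₃′`,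
`0 < a₀`, `0 < a₁`) — the member at which K0a's K0 closers of the C¹ route (FILE 13b ∕ 13d ∕ 14b) and dag-n26-c's N26 rows are stated, and on which plan g67 may re-base the rev-20 K0 ∕ K1
skeletons (V8-CALL (2)).  The proofs are 12E §2's ∕ 12I §2's with the token swap `theta13OfThm1C ↦ theta13OfThm1CC1`, `stage12NumericsOfThm1C ↦ stage12NumericsOfThm1CC1`, letters
`(ε₀ ε₂₉ B₃ a₀ a₁) ↦ (ε₀ ε₂₉ B₃ B₃' a₀ a₁)`.  Nothing of Bałaban's is asserted or proved; NO estimate; N12's per-run displays (the (1.100) pin equation, live-mass at level `kSel P + 1`,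
Proposition 1 (1.78), (1.80), (1.89) — or, at the `Λ`-pinned layer, their printed residues) stay DISPLAYED; the witness-CLASS caveat of referee PLACEMENT-21 ∕ director-ym №146 (`εreg = a₀`
by `rfl` here too: K0a's `theta13OfThm1CC1_εreg`) concerns the K1 consequent at this witness, not these N12 rows.  N12 is NOT discharged; counts unmoved (Track A discharged 5∕28).  ONE
finite four-torus programme at fixed `ε = L^{-K}` — nothing continuum ∕ ℝ⁴ ∕ OS ∕ mass gap ∕ Clay.

WHAT THIS FILE GIVES (all count-neutral, all EDITION-FREE):
* §1 ★★ `b15Leaf_WOfRecord₁₃_theta13OfThm1CC1_of_massLive` (N12's row at `θ₁₅ᶜᶜ¹`, `kSel P < K`, from the pin equation + live-mass + Prop. 1 + (1.80) + (1.89); ZERO K0-side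
  hypotheses) and `…_all_of_massLive` (whole tower, the `K ≤ kSel P` leaf handed — the `h12` slot of dag-n24-c's four-pin sockets at `θ₁₅ᶜᶜ¹`).
* §2 `new189_pinAllTHΛ_theta13OfThm1CC1_one_zero` (the (1.80) ∕ (1.89) antecedent holds at `(1, 0)` on runs in the window: §2's displays are not vacuous) and ★★★
  `b15Leaf_WOfRecord₁₃_pinAllΛ_N0_theta13OfThm1CC1_of_massLive_of_flow` — N12's MOST-PINNED row at `θ₁₅ᶜᶜ¹` (letter of record `λᴧ`, dag-n12-e module 16): ZERO K0-side hypotheses,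
  NO (1.89) display, NO located-geometry binder, `0 < M` discharged (`θ₁₅ᶜᶜ¹.τ9.M = 1`, K0a's `theta13OfThm1CC1_τ9_M`).
* §3 the three term-constant signs at `θ₁₅ᶜᶜ¹` (`kappa ∕ E0 ∕ B0_nonneg_theta13OfThm1CC1`; `θ₁₅ᶜᶜ¹.s2 = sect2NumericsOfThm1C F.L`, the same §2 numerics as `θ₁₅ᶜ` — dag-n11-e's
  `…_theta13OfThm1C` proofs verbatim) — the inputs of dag-n11-e's h-free N13 (R₁₃) row `laws₁₃_of_liveSel_of_hasResiduals` at this witness, for the ⁵ four-pin sockets at `θ₁₅ᶜᶜ¹`.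
WHAT N12 COSTS PER RUN AT `θ₁₅ᶜᶜ¹` (kernel = ★★★'s hypothesis list; typing strength, NOT a second gap; identical to 12I's list at `θ₁₅ᶜ`): live-mass at level `kSel P + 1` (NODE 00) · Prop. 1
at `λ.LF P` · the levels `hlog ∕ hNN ∕ hNk` · the situation's residual numbers + print's two p. 200 conditions · the flow inputs `hε0 ∕ hε1 ∕ hflow` · the coupling step `hgpos ∕ hgstep ∕
hgle` · `Λ ≠ ∅` · the four ℍ-leaves + (1.80).

Sources: [Balaban1989LargeFieldI] (0.2)–(0.6) p.176, (1.73) p.192, Prop. 1 (1.78) p.194, (1.80) p.195, (1.82) p.196, (1.88)–(1.90) pp.197–198, (1.99)–(1.102) pp.200–201;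
[Balaban1988Convergent] (2.1)–(2.10) pp.254–256, (3.16)–(3.25) pp.268–270; [Balaban1987RG1] (0.20) p.256, (1.18) p.263; [Balaban1985Variational] Thm 1 p.279 (witness letters only).
-/

noncomputable section

open MeasureTheory
open scoped Matrix.Norms.L2Operator

namespace Summit.QuantumFields.YangMills.BalabanUVNodes.N12AtTheta13OfThm1CC1

open Literature.MathematicalPhysics.QuantumFieldTheory.Balaban1983to89
open Literature.MathematicalPhysics.QuantumFieldTheory.Balaban1983to89.T4Continuum (T4Family)
open Literature.MathematicalPhysics.QuantumFieldTheory.Balaban1983to89.DagBinding (PrintedCarriers15 B15Leaf)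
open Literature.MathematicalPhysics.QuantumFieldTheory.Balaban1983to89.Node00
open B15Claim189Assembly (Setting189 new189 chiPP dom half)
open B15 (Prop1Printed Ineq180)
open B15.BasicStep (Claim189)
open B15.PrelimIntegrations (Ineq191 Ineq195)
open B15Chi124DetSets (E124)
open B15DeterminingSets (MSField)
open B14DomainGeom (Pt)
open B8Eq17ClassAkV1 (plaqsOf)
open GaugeGroup (dist1)
open GaugeField (plaqHol)
open B15Claim189PrintedConditions (omegaOfChain)
open B15Claim189PinsOfHistory (sitOfHist N0OfRecord₁₃ D189OfHist)
open B15Claim189LambdaPin (enlD)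
open B15RPrime1100OfRep (rPrimeDataOfSel)
open Summit.QuantumFields.YangMills.BalabanUVNodes.N12AtRecord13OfResiduals (b15Leaf_WOfRecord₁₃_theta13LiveOfNumerics_of_massLive
  b15Leaf_WOfRecord₁₃_liveRepin₁₃_all_of_massLive_of_hasResiduals)
open Summit.QuantumFields.YangMills.BalabanUVNodes.N12AtRecord13TermPinned (new189_pinAllTH_liveRepin₁₃_one_zero)
open Summit.QuantumFields.YangMills.BalabanUVNodes.N12AtRecord13TermPinnedLambda (b15Leaf_WOfRecord₁₃_pinAllΛ_N0_liveRepin₁₃_of_massLive_of_hasResiduals_of_flow)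

variable {N : ℕ} [NeZero N] {F : T4Family}

/-! ## §1 N12's ROW AT `θ₁₅ᶜᶜ¹` FROM ITS PER-RUN DISPLAYS — ZERO K0-SIDE HYPOTHESES -/

section Leaf
variable (lam : ResidW F N)

variable (ε₀ ε₂₉ B₃ B₃' a₀ a₁ : ℝ) in
/-- **★★ N12's ROW AT node00-def-K0a FILE 13a's WITNESS OF THE C¹ ROUTE `θ₁₅ᶜᶜ¹ = theta13OfThm1CC1 F N ε₀ ε₂₉ B₃ B₃' a₀ a₁`** — the member of the all-numerics live family at
`stage12NumericsOfThm1CC1` (K0a: the re-pin at which every letter inequality of node00-def-P11's C¹ supplier is a theorem; the K0 closers of FILE 13b ∕ 13d ∕ 14b are stated there) — WITH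
ZERO K0-SIDE HYPOTHESES: not even the six witness signs (12E's numerics-generic ★★ `b15Leaf_WOfRecord₁₃_theta13LiveOfNumerics_of_massLive` at `n := stage12NumericsOfThm1CC1 F.L ε₀ B₃ B₃' a₀ a₁`,
`rfl`). [cite: Balaban1989LargeFieldI, (0.2)–(0.6) p.176, p.176 ll.14–16, Prop. 1 (1.78) p.194, (1.80) p.195, (1.89) p.198, (1.99)–(1.102) pp.200–201; Balaban1988Convergent, (3.16) p.268, (3.22)–(3.25) pp.269–270; Balaban1985Variational, Thm 1 p.279 (witness letters only)] -/
theorem b15Leaf_WOfRecord₁₃_theta13OfThm1CC1_of_massLive {P : B12.RunParams} (hk : lam.kSel P < P.K)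
    (hpin : lam.D1100 P
      = rPrimeDataOfSel (reprTOfRecord₁₃ F N (theta13OfThm1CC1 F N ε₀ ε₂₉ B₃ B₃' a₀ a₁) P (lam.kSel P))
          ((theta13OfThm1CC1 F N ε₀ ε₂₉ B₃ B₃' a₀ a₁).ppSel P (gOfRecord₁₃ F N (theta13OfThm1CC1 F N ε₀ ε₂₉ B₃ B₃' a₀ a₁) P) (lam.kSel P + 1))
          (fibOfSeq F (theta13OfThm1CC1 F N ε₀ ε₂₉ B₃ B₃' a₀ a₁).ν (theta13OfThm1CC1 F N ε₀ ε₂₉ B₃ B₃' a₀ a₁).τ9 P (gOfRecord₁₃ F N (theta13OfThm1CC1 F N ε₀ ε₂₉ B₃ B₃' a₀ a₁) P) (lam.kSel P + 1)))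
    (hmassLive : ∀ s, LiveSeq F N (theta13OfThm1CC1 F N ε₀ ε₂₉ B₃ B₃' a₀ a₁).ν (theta13OfThm1CC1 F N ε₀ ε₂₉ B₃ B₃' a₀ a₁).τ9 P (gOfRecord₁₃ F N (theta13OfThm1CC1 F N ε₀ ε₂₉ B₃ B₃' a₀ a₁) P) (lam.kSel P + 1)
        (slotsTOfRecord F N (theta13OfThm1CC1 F N ε₀ ε₂₉ B₃ B₃' a₀ a₁).ν (theta13OfThm1CC1 F N ε₀ ε₂₉ B₃ B₃' a₀ a₁).τ9 (EOfRecord₁₃ F N (theta13OfThm1CC1 F N ε₀ ε₂₉ B₃ B₃' a₀ a₁)) (wOfRecord₉ F N (theta13OfThm1CC1 F N ε₀ ε₂₉ B₃ B₃' a₀ a₁).toStage9Params)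
          (theta13OfThm1CC1 F N ε₀ ε₂₉ B₃ B₃' a₀ a₁).ppSel P (gOfRecord₁₃ F N (theta13OfThm1CC1 F N ε₀ ε₂₉ B₃ B₃' a₀ a₁) P) (lam.kSel P + 1)) s →
      0 < ∫ V, rterm (reprTOfRecord₁₃ F N (theta13OfThm1CC1 F N ε₀ ε₂₉ B₃ B₃' a₀ a₁) P (lam.kSel P)) s V ∂(fieldMeasure (F.P P.K) (lam.kSel P + 1) (SU N)))
    (hP1 : Prop1Printed (lam.LF P))
    (h180 : ∀ U, new189 (lam.D189 P) U → ∀ i, (lam.D189 P).h ≤ i → i ≤ (lam.D189 P).k → ∀ q ∈ plaqsOf (dom (lam.D189 P) i),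
      Ineq180 ((lam.D189 P).dev0 U q) ((lam.D189 P).ε (lam.D189 P).k) (lam.D189 P).η (lam.D189 P).B₃ (lam.D189 P).B₅ (lam.D189 P).M (lam.D189 P).δ
        ((lam.D189 P).dist q) (lam.D189 P).O1)
    (h189 : Claim189 (new189 (lam.D189 P)) (chiPP (lam.D189 P))) : B15Leaf (WOfRecord₁₃ F N (theta13OfThm1CC1 F N ε₀ ε₂₉ B₃ B₃' a₀ a₁) lam P) :=
  b15Leaf_WOfRecord₁₃_theta13LiveOfNumerics_of_massLive lam (stage12NumericsOfThm1CC1 F.L ε₀ B₃ B₃' a₀ a₁) ε₂₉ hk hpin hmassLive hP1 h180 h189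

variable (ε₀ ε₂₉ B₃ B₃' a₀ a₁ : ℝ) in
/-- **N12's ROW FOR THE WHOLE TOWER OF RUNS AT `θ₁₅ᶜᶜ¹`, run by run, ZERO K0-SIDE HYPOTHESES** — the `h12` slot of dag-n24-c's four-pin Stage-13 sockets at the C¹ route's witness: below the torus the
pin equation + live-mass + Prop. 1 + (1.80) + (1.89); on runs with `K ≤ kSel P` the leaf handed. [cite: Balaban1989LargeFieldI, (0.2)–(0.6) p.176, Prop. 1 (1.78) p.194, (1.80) p.195, (1.89) p.198, (1.99)–(1.102) pp.200–201 (bookkeeping)] -/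
theorem b15Leaf_WOfRecord₁₃_theta13OfThm1CC1_all_of_massLive
    (hdeg : ∀ P : B12.RunParams, P.K ≤ lam.kSel P → B15Leaf (WOfRecord₁₃ F N (theta13OfThm1CC1 F N ε₀ ε₂₉ B₃ B₃' a₀ a₁) lam P))
    (hpin : ∀ P : B12.RunParams, lam.kSel P < P.K → lam.D1100 P
      = rPrimeDataOfSel (reprTOfRecord₁₃ F N (theta13OfThm1CC1 F N ε₀ ε₂₉ B₃ B₃' a₀ a₁) P (lam.kSel P))
          ((theta13OfThm1CC1 F N ε₀ ε₂₉ B₃ B₃' a₀ a₁).ppSel P (gOfRecord₁₃ F N (theta13OfThm1CC1 F N ε₀ ε₂₉ B₃ B₃' a₀ a₁) P) (lam.kSel P + 1))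
          (fibOfSeq F (theta13OfThm1CC1 F N ε₀ ε₂₉ B₃ B₃' a₀ a₁).ν (theta13OfThm1CC1 F N ε₀ ε₂₉ B₃ B₃' a₀ a₁).τ9 P (gOfRecord₁₃ F N (theta13OfThm1CC1 F N ε₀ ε₂₉ B₃ B₃' a₀ a₁) P) (lam.kSel P + 1)))
    (hmassLive : ∀ P : B12.RunParams, lam.kSel P < P.K → ∀ s, LiveSeq F N (theta13OfThm1CC1 F N ε₀ ε₂₉ B₃ B₃' a₀ a₁).ν (theta13OfThm1CC1 F N ε₀ ε₂₉ B₃ B₃' a₀ a₁).τ9 P (gOfRecord₁₃ F N (theta13OfThm1CC1 F N ε₀ ε₂₉ B₃ B₃' a₀ a₁) P) (lam.kSel P + 1)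
        (slotsTOfRecord F N (theta13OfThm1CC1 F N ε₀ ε₂₉ B₃ B₃' a₀ a₁).ν (theta13OfThm1CC1 F N ε₀ ε₂₉ B₃ B₃' a₀ a₁).τ9 (EOfRecord₁₃ F N (theta13OfThm1CC1 F N ε₀ ε₂₉ B₃ B₃' a₀ a₁)) (wOfRecord₉ F N (theta13OfThm1CC1 F N ε₀ ε₂₉ B₃ B₃' a₀ a₁).toStage9Params)
          (theta13OfThm1CC1 F N ε₀ ε₂₉ B₃ B₃' a₀ a₁).ppSel P (gOfRecord₁₃ F N (theta13OfThm1CC1 F N ε₀ ε₂₉ B₃ B₃' a₀ a₁) P) (lam.kSel P + 1)) s →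
      0 < ∫ V, rterm (reprTOfRecord₁₃ F N (theta13OfThm1CC1 F N ε₀ ε₂₉ B₃ B₃' a₀ a₁) P (lam.kSel P)) s V ∂(fieldMeasure (F.P P.K) (lam.kSel P + 1) (SU N)))
    (hP1 : ∀ P : B12.RunParams, lam.kSel P < P.K → Prop1Printed (lam.LF P))
    (h180 : ∀ P : B12.RunParams, lam.kSel P < P.K → ∀ U, new189 (lam.D189 P) U → ∀ i, (lam.D189 P).h ≤ i → i ≤ (lam.D189 P).k →
      ∀ q ∈ plaqsOf (dom (lam.D189 P) i),
        Ineq180 ((lam.D189 P).dev0 U q) ((lam.D189 P).ε (lam.D189 P).k) (lam.D189 P).η (lam.D189 P).B₃ (lam.D189 P).B₅ (lam.D189 P).M (lam.D189 P).δ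
          ((lam.D189 P).dist q) (lam.D189 P).O1)
    (h189 : ∀ P : B12.RunParams, lam.kSel P < P.K → Claim189 (new189 (lam.D189 P)) (chiPP (lam.D189 P))) :
    ∀ P : B12.RunParams, B15Leaf (WOfRecord₁₃ F N (theta13OfThm1CC1 F N ε₀ ε₂₉ B₃ B₃' a₀ a₁) lam P) :=
  b15Leaf_WOfRecord₁₃_liveRepin₁₃_all_of_massLive_of_hasResiduals
    (theta13OfNumerics F N (stage12NumericsOfThm1CC1 F.L ε₀ B₃ B₃' a₀ a₁) ε₂₉ (zeta316OfRecord F N (stage12NumericsOfThm1CC1 F.L ε₀ B₃ B₃' a₀ a₁).ν (stage12NumericsOfThm1CC1 F.L ε₀ B₃ B₃' a₀ a₁).τ9.M (stage12NumericsOfThm1CC1 F.L ε₀ B₃ B₃' a₀ a₁).A₁) (RzOfRecord F N) (ZtOfRecord F N)) lam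
    (hasResidualsOfRecord_theta13OfNumerics F N (stage12NumericsOfThm1CC1 F.L ε₀ B₃ B₃' a₀ a₁) ε₂₉) hdeg hpin hmassLive hP1 h180 h189

end Leaf

/-! ## §2 THE `Λ`-PINNED MOST-PINNED ROW AT `θ₁₅ᶜᶜ¹` (letter of record `λᴧ := (λ.pinRPrime₁₃ θ₁₅ᶜᶜ¹).pinD189ΛH …`, dag-n12-e module 16) and its non-vacuity certificate -/

section Lambda
variable (ε₀ ε₂₉ B₃ B₃' a₀ a₁ : ℝ) (lam : ResidW F N) (σ : ∀ P : B12.RunParams, Sit189 F N P.K)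
  (s : ∀ P : B12.RunParams, SeqOfRecord F (theta13OfThm1CC1 F N ε₀ ε₂₉ B₃ B₃' a₀ a₁).ν (theta13OfThm1CC1 F N ε₀ ε₂₉ B₃ B₃' a₀ a₁).τ9.M
    (gOfRecord₁₃ F N (theta13OfThm1CC1 F N ε₀ ε₂₉ B₃ B₃' a₀ a₁) P) P.K (lam.kSel P + 1)) (Nm : B12.RunParams → ℕ) (p₁ : ℕ)

/-- **NON-VACUITY AT `θ₁₅ᶜᶜ¹` FOR THE `Λ`-PINNED LAYER, ADMISSIBILITY FROM THE SIX WITNESS SIGNS** (14C's `new189_pinAllTH_liveRepin₁₃_one_zero` at the `Λ`-pinned family, K0a's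
`admissible_theta13OfThm1CC1`): on a run whose ₁₃ history lies in `]0, ½]` up to `n ≥ kSel P + 1`, with residual numbers `0 ≤ β < 1`, `0 < L₀`, `0 ≤ O(1)B₃B₅`, the (1.80) ∕ (1.89) antecedent
`new189 (λᴧ.D189 P) (1, 0)` HOLDS — §2's displays are not vacuous there. [cite: Balaban1989LargeFieldI, (1.82) p.196, (1.89) p.198; Balaban1988Convergent, (2.4) p.255, (2.10) p.256 (bookkeeping census)] -/
theorem new189_pinAllTHΛ_theta13OfThm1CC1_one_zero (hε : 0 < ε₀) (hε' : 0 < ε₂₉) (hB : 0 ≤ B₃) (hB' : 0 ≤ B₃') (ha₀ : 0 < a₀) (ha₁ : 0 < a₁)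
    (P : B12.RunParams) {n : ℕ} (hI : Step.InInterval (theta13OfThm1CC1 F N ε₀ ε₂₉ B₃ B₃' a₀ a₁).γ n (gOfRecord₁₃ F N (theta13OfThm1CC1 F N ε₀ ε₂₉ B₃ B₃' a₀ a₁) P))
    (hkn : lam.kSel P + 1 ≤ n) (hβ0 : 0 ≤ (σ P).β) (hβ1 : (σ P).β < 1) (hL₀ : 0 < (σ P).L₀) (hBB : 0 ≤ (σ P).O1 * (σ P).B₃ * (σ P).B₅) :
    new189 (((lam.pinRPrime₁₃ (theta13OfThm1CC1 F N ε₀ ε₂₉ B₃ B₃' a₀ a₁)).pinD189ΛH (theta13OfThm1CC1 F N ε₀ ε₂₉ B₃ B₃' a₀ a₁).ν (theta13OfThm1CC1 F N ε₀ ε₂₉ B₃ B₃' a₀ a₁).A₁ (theta13OfThm1CC1 F N ε₀ ε₂₉ B₃ B₃' a₀ a₁).τ9.M (gOfRecord₁₃ F N (theta13OfThm1CC1 F N ε₀ ε₂₉ B₃ B₃' a₀ a₁)) σ s Nm p₁).D189 P)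
      ((1 : MSField (F.P P.K) (SU N)), fun _ _ => (0 : EuclideanSpace ℝ (Fin (N ^ 2 - 1)))) :=
  new189_pinAllTH_liveRepin₁₃_one_zero
    (theta13OfNumerics F N (stage12NumericsOfThm1CC1 F.L ε₀ B₃ B₃' a₀ a₁) ε₂₉ (zeta316OfRecord F N (stage12NumericsOfThm1CC1 F.L ε₀ B₃ B₃' a₀ a₁).ν (stage12NumericsOfThm1CC1 F.L ε₀ B₃ B₃' a₀ a₁).τ9.M (stage12NumericsOfThm1CC1 F.L ε₀ B₃ B₃' a₀ a₁).A₁) (RzOfRecord F N) (ZtOfRecord F N))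
    lam (fun P => ((((σ P).pinLambda (s P) (N0OfRecord₁₃ (theta13OfThm1CC1 F N ε₀ ε₂₉ B₃ B₃' a₀ a₁) P (lam.kSel P + 1)) (enlD F (theta13OfThm1CC1 F N ε₀ ε₂₉ B₃ B₃' a₀ a₁).ν (theta13OfThm1CC1 F N ε₀ ε₂₉ B₃ B₃' a₀ a₁).τ9.M P (gOfRecord₁₃ F N (theta13OfThm1CC1 F N ε₀ ε₂₉ B₃ B₃' a₀ a₁) P))).pinDistAt (lam.kSel P + 1)).pinZpp (s P) (N0OfRecord₁₃ (theta13OfThm1CC1 F N ε₀ ε₂₉ B₃ B₃' a₀ a₁) P (lam.kSel P + 1)) (Nm P) (enlD F (theta13OfThm1CC1 F N ε₀ ε₂₉ B₃ B₃' a₀ a₁).ν (theta13OfThm1CC1 F N ε₀ ε₂₉ B₃ B₃' a₀ a₁).τ9.M P (gOfRecord₁₃ F N (theta13OfThm1CC1 F N ε₀ ε₂₉ B₃ B₃' a₀ a₁) P))).pinCubes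
      (((((σ P).pinLambda (s P) (N0OfRecord₁₃ (theta13OfThm1CC1 F N ε₀ ε₂₉ B₃ B₃' a₀ a₁) P (lam.kSel P + 1)) (enlD F (theta13OfThm1CC1 F N ε₀ ε₂₉ B₃ B₃' a₀ a₁).ν (theta13OfThm1CC1 F N ε₀ ε₂₉ B₃ B₃' a₀ a₁).τ9.M P (gOfRecord₁₃ F N (theta13OfThm1CC1 F N ε₀ ε₂₉ B₃ B₃' a₀ a₁) P))).pinDistAt (lam.kSel P + 1)).pinZpp (s P) (N0OfRecord₁₃ (theta13OfThm1CC1 F N ε₀ ε₂₉ B₃ B₃' a₀ a₁) P (lam.kSel P + 1)) (Nm P) (enlD F (theta13OfThm1CC1 F N ε₀ ε₂₉ B₃ B₃' a₀ a₁).ν (theta13OfThm1CC1 F N ε₀ ε₂₉ B₃ B₃' a₀ a₁).τ9.M P (gOfRecord₁₃ F N (theta13OfThm1CC1 F N ε₀ ε₂₉ B₃ B₃' a₀ a₁) P))).OmTᶜ ∩ omegaOfChain (s P) (lam.kSel P + 1 - Nm P))) s Nm (fun P => N0OfRecord₁₃ (theta13OfThm1CC1 F N ε₀ ε₂₉ B₃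 B₃' a₀ a₁) P (lam.kSel P + 1)) p₁
    (admissible_theta13OfThm1CC1 F N hε hε' hB hB' ha₀ ha₁) P hI hkn hβ0 hβ1 hL₀ hBB

/-- **★★★ N12's MOST-PINNED ROW OF RECORD AT `θ₁₅ᶜᶜ¹`: the `Λ`-, cube-, distance-, `Z″`- and `N₀`-pinned term-pinned bundle `WOfRecord₁₃ θ₁₅ᶜᶜ¹ λᴧ P`, `kSel P < K` — ZERO K0-SIDE HYPOTHESES, NO (1.89)
DISPLAY, NO LOCATED-GEOMETRY BINDER** (12I §1 at `Θ := theta13OfNumerics … (stage12NumericsOfThm1CC1 …) …`, whose ₁₃ live re-pin IS `θ₁₅ᶜᶜ¹`).  THE KERNEL's LIST OF WHAT N12 COSTS PER RUN AT THE C¹ ROUTE's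
WITNESS = this hypothesis list (identical in shape to 12I's ★★★ at `θ₁₅ᶜ`): live-mass at level `kSel P + 1`; Prop. 1 at `λ.LF P`; the levels; the situation's residual numbers and print's two p. 200 conditions; the flow
inputs; the coupling step; `Λ ≠ ∅`; the four ℍ-leaves and (1.80) — `0 < M` is DISCHARGED here (`M` of record at `θ₁₅ᶜᶜ¹` is `1`, `rfl`; print's «M large» survives only as the residual `hMl`). [cite: Balaban1989LargeFieldI, (0.2)–(0.6) p.176, p.176 ll.14–16, (1.73) p.192, Prop. 1 (1.78) p.194, (1.80) p.195, (1.10)–(1.11) p.179, (1.88)–(1.90) pp.197–198, pp.199–201; Balaban1988Convergent, (2.1) p.254, (2.5)–(2.8) pp.255–256, (2.17) p.257, (3.16) p.268, (3.22)–(3.25) pp.269–270; Balaban1987RG1, (0.20) p.256; Balaban1985Variational, Thm 1 p.279 (witness letters only)] -/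
theorem b15Leaf_WOfRecord₁₃_pinAllΛ_N0_theta13OfThm1CC1_of_massLive_of_flow
    {P : B12.RunParams} (hK : lam.kSel P < P.K) (hsh : 0 < (σ P).sh)
    {D : Setting189 (F.P P.K) (SU N) (MSField (F.P P.K) (SU N) × ((j : ℕ) → VecField (F.P P.K) j (EuclideanSpace ℝ (Fin (N ^ 2 - 1))))) (Pt (F.P P.K).d)}
    (hD : D = ((lam.pinRPrime₁₃ (theta13OfThm1CC1 F N ε₀ ε₂₉ B₃ B₃' a₀ a₁)).pinD189ΛH (theta13OfThm1CC1 F N ε₀ ε₂₉ B₃ B₃' a₀ a₁).ν (theta13OfThm1CC1 F N ε₀ ε₂₉ B₃ B₃' a₀ a₁).A₁ (theta13OfThm1CC1 F N ε₀ ε₂₉ B₃ B₃' a₀ a₁).τ9.M (gOfRecord₁₃ F N (theta13OfThm1CC1 F N ε₀ ε₂₉ B₃ B₃' a₀ a₁)) σ s Nm p₁).D189 P)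
    (hmassLive : ∀ a, LiveSeq F N (theta13OfThm1CC1 F N ε₀ ε₂₉ B₃ B₃' a₀ a₁).ν (theta13OfThm1CC1 F N ε₀ ε₂₉ B₃ B₃' a₀ a₁).τ9 P (gOfRecord₁₃ F N (theta13OfThm1CC1 F N ε₀ ε₂₉ B₃ B₃' a₀ a₁) P) (lam.kSel P + 1)
        (slotsTOfRecord F N (theta13OfThm1CC1 F N ε₀ ε₂₉ B₃ B₃' a₀ a₁).ν (theta13OfThm1CC1 F N ε₀ ε₂₉ B₃ B₃' a₀ a₁).τ9 (EOfRecord₁₃ F N (theta13OfThm1CC1 F N ε₀ ε₂₉ B₃ B₃' a₀ a₁)) (wOfRecord₉ F N (theta13OfThm1CC1 F N ε₀ ε₂₉ B₃ B₃' a₀ a₁).toStage9Params)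
          (theta13OfThm1CC1 F N ε₀ ε₂₉ B₃ B₃' a₀ a₁).ppSel P (gOfRecord₁₃ F N (theta13OfThm1CC1 F N ε₀ ε₂₉ B₃ B₃' a₀ a₁) P) (lam.kSel P + 1)) a →
      0 < ∫ V, rterm (reprTOfRecord₁₃ F N (theta13OfThm1CC1 F N ε₀ ε₂₉ B₃ B₃' a₀ a₁) P (lam.kSel P)) a V ∂(fieldMeasure (F.P P.K) (lam.kSel P + 1) (SU N)))
    (hP1 : Prop1Printed (lam.LF P))
    (hlog : 1 < (Real.log (gOfRecord₁₃ F N (theta13OfThm1CC1 F N ε₀ ε₂₉ B₃ B₃' a₀ a₁) P (lam.kSel P + 1) ^ 2)⁻¹) ^ (theta13OfThm1CC1 F N ε₀ ε₂₉ B₃ B₃' a₀ a₁).ν.r)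
    (hNN : N0OfRecord₁₃ (theta13OfThm1CC1 F N ε₀ ε₂₉ B₃ B₃' a₀ a₁) P (lam.kSel P + 1) ≤ Nm P) (hNk : N0OfRecord₁₃ (theta13OfThm1CC1 F N ε₀ ε₂₉ B₃ B₃' a₀ a₁) P (lam.kSel P + 1) ≤ lam.kSel P + 1)
    (hβ0 : 0 ≤ (σ P).β) (hβ : (σ P).β ≤ 1 / 4) (hL₀ : 2 ≤ (σ P).L₀) (hL₀L : (σ P).L₀ ^ 2 ≤ ((F.P P.K).L : ℝ))
    (hB : 0 ≤ (σ P).O1 * (σ P).B₃ * (σ P).B₅) (hδ : 0 ≤ (σ P).δ)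
    (hN₀ : (2 + (121 / 120) ^ 2 * ((σ P).O1 * (σ P).B₃ * (σ P).B₅ * ((theta13OfThm1CC1 F N ε₀ ε₂₉ B₃ B₃' a₀ a₁).τ9.M : ℝ) ^ 5)) *
      ((((σ P).L₀ ^ 2) ^ (N0OfRecord₁₃ (theta13OfThm1CC1 F N ε₀ ε₂₉ B₃ B₃' a₀ a₁) P (lam.kSel P + 1) - 1))⁻¹) ≤ 1 / 4)
    (hMl : (121 / 120) ^ 2 * ((σ P).O1 * (σ P).B₃ * (σ P).B₅ * ((theta13OfThm1CC1 F N ε₀ ε₂₉ B₃ B₃' a₀ a₁).τ9.M : ℝ) ^ 5) * Real.exp (-(4 * (σ P).δ * ((theta13OfThm1CC1 F N ε₀ ε₂₉ B₃ B₃' a₀ a₁).τ9.M : ℝ))) ≤ 1 / 12)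
    (hε0 : ∀ i, lam.kSel P + 1 - Nm P ≤ i → i ≤ lam.kSel P + 1 → 0 ≤ epsOfRecord (theta13OfThm1CC1 F N ε₀ ε₂₉ B₃ B₃' a₀ a₁).ν (gOfRecord₁₃ F N (theta13OfThm1CC1 F N ε₀ ε₂₉ B₃ B₃' a₀ a₁) P) i)
    (hε1 : ∀ i, lam.kSel P + 1 - Nm P ≤ i → i ≤ lam.kSel P + 1 → epsOfRecord (theta13OfThm1CC1 F N ε₀ ε₂₉ B₃ B₃' a₀ a₁).ν (gOfRecord₁₃ F N (theta13OfThm1CC1 F N ε₀ ε₂₉ B₃ B₃' a₀ a₁) P) i ≤ 1 / 10)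
    {β₀ : ℝ} (hβ₀0 : 0 ≤ β₀) (hβ₀ : β₀ ≤ 1 / 2)
    (hflow : ∀ j, lam.kSel P + 1 - Nm P ≤ j → j < lam.kSel P + 1 → epsOfRecord (theta13OfThm1CC1 F N ε₀ ε₂₉ B₃ B₃' a₀ a₁).ν (gOfRecord₁₃ F N (theta13OfThm1CC1 F N ε₀ ε₂₉ B₃ B₃' a₀ a₁) P) (lam.kSel P + 1)
      ≤ (1 + β₀) * Real.sqrt ((lam.kSel P + 1 - j : ℕ) : ℝ) * epsOfRecord (theta13OfThm1CC1 F N ε₀ ε₂₉ B₃ B₃' a₀ a₁).ν (gOfRecord₁₃ F N (theta13OfThm1CC1 F N ε₀ ε₂₉ B₃ B₃' a₀ a₁) P) j)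
    -- the `N₀`-equation's one step of monotone couplings, and `Λ ≠ ∅` (a non-trivial 𝐑-step)
    (hgpos : 0 < (gOfRecord₁₃ F N (theta13OfThm1CC1 F N ε₀ ε₂₉ B₃ B₃' a₀ a₁) P) (lam.kSel P + 1 + 1 - (N0OfRecord₁₃ (theta13OfThm1CC1 F N ε₀ ε₂₉ B₃ B₃' a₀ a₁) P (lam.kSel P + 1))))
    (hgstep : (gOfRecord₁₃ F N (theta13OfThm1CC1 F N ε₀ ε₂₉ B₃ B₃' a₀ a₁) P) (lam.kSel P + 1 + 1 - (N0OfRecord₁₃ (theta13OfThm1CC1 F N ε₀ ε₂₉ B₃ B₃' a₀ a₁) P (lam.kSel P + 1))) ≤ (gOfRecord₁₃ F N (theta13OfThm1CC1 F N ε₀ ε₂₉ B₃ B₃' a₀ a₁) P) (lam.kSel P + 1 + 2 - (N0OfRecord₁₃ (theta13OfThm1CC1 F N ε₀ ε₂₉ B₃ B₃' a₀ a₁) P (lam.kSel P + 1))))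
    (hgle : (gOfRecord₁₃ F N (theta13OfThm1CC1 F N ε₀ ε₂₉ B₃ B₃' a₀ a₁) P) (lam.kSel P + 1 + 2 - (N0OfRecord₁₃ (theta13OfThm1CC1 F N ε₀ ε₂₉ B₃ B₃' a₀ a₁) P (lam.kSel P + 1))) ≤ 1)
    (hΛ : (((enlD F (theta13OfThm1CC1 F N ε₀ ε₂₉ B₃ B₃' a₀ a₁).ν (theta13OfThm1CC1 F N ε₀ ε₂₉ B₃ B₃' a₀ a₁).τ9.M P (gOfRecord₁₃ F N (theta13OfThm1CC1 F N ε₀ ε₂₉ B₃ B₃' a₀ a₁) P)) 4 (lam.kSel P + 1 + 1 - (N0OfRecord₁₃ (theta13OfThm1CC1 F N ε₀ ε₂₉ B₃ B₃' a₀ a₁) P (lam.kSel P + 1)))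
        (omegaOfChain (s P) (lam.kSel P + 1 + 1 - (N0OfRecord₁₃ (theta13OfThm1CC1 F N ε₀ ε₂₉ B₃ B₃' a₀ a₁) P (lam.kSel P + 1)))))ᶜ ∩ (σ P).Z).Nonempty)
    (L91h : ∀ U, new189 D U → ∀ p ∈ plaqsOf (half D),
      Ineq191 (dist1 (plaqHol (D.Upp U) p)) (D.devV'' U p) D.α ((D.L ^ D.h)⁻¹) (D.ε D.h) (E124 D.ε D.L D.η D.k D.h))
    (L95 : ∀ U, new189 D U → ∀ p ∈ plaqsOf (half D),
      Ineq195 (D.devV'' U p) (dist1 (plaqHol (D.Uhalf U (D.boxOf p)) p)) D.α ((D.L ^ D.h)⁻¹) (D.ε D.h) (E124 D.ε D.L D.η D.k D.h))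
    (L91 : ∀ U, new189 D U → ∀ j, D.h ≤ j → j ≤ D.k → ∀ p ∈ plaqsOf (dom D j),
      Ineq191 (dist1 (plaqHol (D.Upp U) p)) (D.dev97 U p) D.α ((D.L ^ j)⁻¹) (D.ε j) (E124 D.ε D.L D.η D.k j))
    (L97 : ∀ U, new189 D U → ∀ j, D.h ≤ j → j ≤ D.k → ∀ p ∈ plaqsOf (dom D j),
      Ineq191 (D.dev97 U p) (D.dev0 U p) D.α ((D.L ^ j)⁻¹) (D.ε j) (E124 D.ε D.L D.η D.k j))
    (L80 : ∀ U, new189 D U → ∀ j, D.h ≤ j → j ≤ D.k → ∀ p ∈ plaqsOf (dom D j),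
      Ineq180 (D.dev0 U p) (D.ε D.k) D.η D.B₃ D.B₅ D.M D.δ (D.dist p) D.O1) :
    B15Leaf (WOfRecord₁₃ F N (theta13OfThm1CC1 F N ε₀ ε₂₉ B₃ B₃' a₀ a₁)
      ((lam.pinRPrime₁₃ (theta13OfThm1CC1 F N ε₀ ε₂₉ B₃ B₃' a₀ a₁)).pinD189ΛH (theta13OfThm1CC1 F N ε₀ ε₂₉ B₃ B₃' a₀ a₁).ν (theta13OfThm1CC1 F N ε₀ ε₂₉ B₃ B₃' a₀ a₁).A₁ (theta13OfThm1CC1 F N ε₀ ε₂₉ B₃ B₃' a₀ a₁).τ9.M (gOfRecord₁₃ F N (theta13OfThm1CC1 F N ε₀ ε₂₉ B₃ B₃' a₀ a₁)) σ s Nm p₁) P) :=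
  b15Leaf_WOfRecord₁₃_pinAllΛ_N0_liveRepin₁₃_of_massLive_of_hasResiduals_of_flow
    (theta13OfNumerics F N (stage12NumericsOfThm1CC1 F.L ε₀ B₃ B₃' a₀ a₁) ε₂₉ (zeta316OfRecord F N (stage12NumericsOfThm1CC1 F.L ε₀ B₃ B₃' a₀ a₁).ν (stage12NumericsOfThm1CC1 F.L ε₀ B₃ B₃' a₀ a₁).τ9.M (stage12NumericsOfThm1CC1 F.L ε₀ B₃ B₃' a₀ a₁).A₁) (RzOfRecord F N) (ZtOfRecord F N)) lam σ s Nm p₁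
    (hasResidualsOfRecord_theta13OfNumerics F N (stage12NumericsOfThm1CC1 F.L ε₀ B₃ B₃' a₀ a₁) ε₂₉) hK hsh
    Nat.one_pos -- `M` of record at `θ₁₅ᶜᶜ¹` is `1` (`rfl`, K0a's `theta13OfThm1CC1_τ9_M`): print's «M large» survives only as the residual `hMl`
    hD hmassLive hP1 hlog hNN hNk hβ0 hβ hL₀ hL₀L hB hδ hN₀ hMl hε0 hε1 hβ₀0 hβ₀ hflow
    hgpos hgstep hgle hΛ L91h L95 L91 L97 L80

end Lambda

/-! ## §3 THE THREE TERM-CONSTANT SIGNS AT `θ₁₅ᶜᶜ¹` (inputs of dag-n11-e's h-free N13 (R₁₃) row at this witness; `θ₁₅ᶜᶜ¹.s2 = sect2NumericsOfThm1C F.L`) -/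

section Signs

/-- `θ₁₅ᶜᶜ¹`'s decay rate is `κ = 2·10⁴ ≥ 0` (K0a's `theta13OfThm1CC1_κ`; dag-n11-e's `kappa_nonneg_theta13OfThm1C` at the C¹ witness, same binder order `F N ε₀ …`). [cite: Balaban1987RG1, (1.18) p.263 (bookkeeping witness)] -/
theorem kappa_nonneg_theta13OfThm1CC1 (F : T4Family) (N : ℕ) [NeZero N] (ε₀ ε₂₉ B₃ B₃' a₀ a₁ : ℝ) : 0 ≤ (theta13OfThm1CC1 F N ε₀ ε₂₉ B₃ B₃' a₀ a₁).s2.lf.κ := by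
  rw [theta13OfThm1CC1_κ]; norm_num

/-- `θ₁₅ᶜᶜ¹`'s term constants have `E₀ = 1 ≥ 0` (`rfl` through `theta13OfThm1CC1_s2`). [cite: Balaban1988Convergent, (2.31) p.260 (bookkeeping witness)] -/
theorem E0_nonneg_theta13OfThm1CC1 (F : T4Family) (N : ℕ) [NeZero N] (ε₀ ε₂₉ B₃ B₃' a₀ a₁ : ℝ) : 0 ≤ (theta13OfThm1CC1 F N ε₀ ε₂₉ B₃ B₃' a₀ a₁).s2.lf.E₀ := by
  have hE : (theta13OfThm1CC1 F N ε₀ ε₂₉ B₃ B₃' a₀ a₁).s2.lf.E₀ = 1 := rfl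
  rw [hE]; exact zero_le_one

/-- `θ₁₅ᶜᶜ¹`'s term constants have `B₀ = 1 ≥ 0` (`rfl`). [cite: Balaban1988Convergent, (2.42) p.261 (bookkeeping witness)] -/
theorem B0_nonneg_theta13OfThm1CC1 (F : T4Family) (N : ℕ) [NeZero N] (ε₀ ε₂₉ B₃ B₃' a₀ a₁ : ℝ) : 0 ≤ (theta13OfThm1CC1 F N ε₀ ε₂₉ B₃ B₃' a₀ a₁).s2.lf.B₀ := by
  have hB : (theta13OfThm1CC1 F N ε₀ ε₂₉ B₃ B₃' a₀ a₁).s2.lf.B₀ = 1 := rfl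
  rw [hB]; exact zero_le_one

end Signs

end Summit.QuantumFields.YangMills.BalabanUVNodes.N12AtTheta13OfThm1CC1
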